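import Mathlib.Algebra.Field.ZMod
import Literature.Computability.AlgebraicComplexity.BrentTermTypes
import Literature.Computability.AlgebraicComplexity.SmallFormatRankLaderman
import HarnessLib

/-!
# The core of a scheme (Heule–Kauers–Seidl, SAT 2019): Laderman's core is four quadruples

Topic `Literature/Computability/AlgebraicComplexity`; companion of `BrentTermTypes.lean` (HKS19 §2:
types of terms; "all 27 type 3 terms must be produced by the 23 summands, some summands must produce
more than one type 3 term") and `SmallFormatRankLaderman.lean` (Laderman's 23 products
`ladermanW/U/V`). Source: M. J. H. Heule, M. Kauers, M. Seidl, *Local Search for Fast Matrix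
Multiplication*, SAT 2019, LNCS 11628, arXiv:1903.11391 (HKS19).

Printed (§3, p. 5): "The core of a scheme is the pairing of the type 3 terms."  (§4, p. 6): "We can
also see that the Laderman scheme differs in many ways from all the other solutions. It is, for
example, the only scheme whose core consists of four quadruples of type 3 terms. In 89% of the
solutions, the core consists of four pairs of type 3 terms, about 10% of the solution have three
pairs and one quadrupel, and less than 1% of the schemes have cores of the form 2-2-2-2-3 or
2-2-2-3-4."  (§3.1: "randomly pair four type 3 terms and assign the remaining type 3 terms to the
other 19 summands.")

What is typed (everything PROVED, no named facts; all evaluations by `decide` in the kernel):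
* `type3Produced w u v ρ` — the type-3 terms `(κ,μ,ν)` PRODUCED by summand `ρ` (non-zero coefficient
  `w_ρ(κ,ν) u_ρ(κ,μ) v_ρ(μ,ν)`); `type3Count`; `coreShape w u v` — the multiset of the sizes `≥ 2`
  of these groups (HKS's "pairs", "quadruples", "2-2-2-2-3": the summands producing a single type-3
  term are not listed), i.e. the shape of "the pairing of the type 3 terms".
* For Laderman's scheme read over `ℤ₂` (as in HKS's data; the supports of Laderman's `±1` entries are
  the same over `ℤ`): **`laderman_coreShape : coreShape = {4, 4, 4, 4}`** ("four quadruples"),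
  `laderman_card_type3Count_eq_one` (the other `19` summands produce exactly one type-3 term each),
  `laderman_sum_type3Count` (`35` type-3 occurrences in total), `laderman_type3_multiplicities` (of the
  `27` type-3 terms, `23` are produced once and `4` three times — an odd number each, as
  `heuleKauersSeidl2019_type3_survive` requires over `ℤ₂`).
The statistical clauses ("the only scheme …", "89% …") are statements about HKS's data set and are not
typed.

## References

* M. J. H. Heule, M. Kauers, M. Seidl, *Local Search for Fast Matrix Multiplication*, Proc. SAT 2019,
  LNCS 11628, 155–163, doi:10.1007/978-3-030-24258-9_10, arXiv:1903.11391, §3 (the core), §4.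
  [HeuleKauersSeidl2019]
* J. D. Laderman, *A noncommutative algorithm for multiplying 3×3 matrices using 23
  multiplications*, Bull. AMS 82 (1976) 126–128. [Laderman1976]
-/

namespace Literature.Computability.AlgebraicComplexity

open scoped BigOperators

namespace BrentTermTypes

variable {K : Type*} [CommRing K] [DecidableEq K] {σ : Type*} [Fintype σ] {k m n : ℕ}

/-- **HKS19 §3, "the pairing of the type 3 terms":** the type-3 terms `(κ, μ, ν)` (the term
`Z_{κν} X_{κμ} Y_{μν}`, `type3Term`) produced with a non-zero coefficient by summand `ρ` of the scheme
`Σ_ρ w_ρ ⊗ u_ρ ⊗ v_ρ`. [cite: HeuleKauersSeidl2019, §3 (the core of a scheme)] -/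
def type3Produced (w : σ → Fin k × Fin n → K) (u : σ → Fin k × Fin m → K)
    (v : σ → Fin m × Fin n → K) (ρ : σ) : Finset (Fin k × Fin m × Fin n) :=
  Finset.univ.filter fun q => w ρ (q.1, q.2.2) * u ρ (q.1, q.2.1) * v ρ (q.2.1, q.2.2) ≠ 0

/-- The number of type-3 terms produced by summand `ρ`. [cite: HeuleKauersSeidl2019, §3 (the core of a scheme)] -/
def type3Count (w : σ → Fin k × Fin n → K) (u : σ → Fin k × Fin m → K)
    (v : σ → Fin m × Fin n → K) (ρ : σ) : ℕ :=
  (type3Produced w u v ρ).card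

/-- **The shape of the core** ("four quadruples", "four pairs", "three pairs and one quadrupel",
"2-2-2-2-3", "2-2-2-3-4"): the multiset of the numbers `≥ 2` of type-3 terms produced by the single
summands. [cite: HeuleKauersSeidl2019, §3–§4 (the core of a scheme)] -/
def coreShape (w : σ → Fin k × Fin n → K) (u : σ → Fin k × Fin m → K)
    (v : σ → Fin m × Fin n → K) : Multiset ℕ :=
  ((Finset.univ : Finset σ).val.map (type3Count w u v)).filter fun c => 2 ≤ c

end BrentTermTypes

/-! ## Laderman's scheme: "four quadruples of type 3 terms" -/

section Laderman

open BrentTermTypes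

/-- **HKS19 §4: "the Laderman scheme … is … the only scheme whose core consists of four quadruples
of type 3 terms"** — the part about Laderman's scheme (read over `ℤ₂`): exactly four of its `23`
products produce more than one type-3 term, and each of these produces four.
[cite: HeuleKauersSeidl2019, §4] -/
theorem laderman_coreShape :
    coreShape (ladermanW (ZMod 2)) (ladermanU (ZMod 2)) (ladermanV (ZMod 2)) = {4, 4, 4, 4} := by
  decide

/-- The other `19` products of Laderman's scheme produce exactly one type-3 term each (HKS19 §3.1:
"assign the remaining type 3 terms to the other 19 summands"). [cite: HeuleKauersSeidl2019, §3.1 and §4] -/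
theorem laderman_card_type3Count_eq_one :
    (Finset.univ.filter fun ρ =>
      type3Count (ladermanW (ZMod 2)) (ladermanU (ZMod 2)) (ladermanV (ZMod 2)) ρ = 1).card = 19 := by
  decide

/-- Every product of Laderman's scheme produces at least one type-3 term (none produces zero).
[cite: HeuleKauersSeidl2019, §4 (cores) and §5 (Challenge 3)] -/
theorem laderman_type3Count_pos (ρ : LadermanIndex) :
    0 < type3Count (ladermanW (ZMod 2)) (ladermanU (ZMod 2)) (ladermanV (ZMod 2)) ρ := by
  revert ρ
  decide

/-- In total Laderman's `23` products produce `4·4 + 19 = 35` type-3 terms (with multiplicity).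
[cite: HeuleKauersSeidl2019, §4] -/
theorem laderman_sum_type3Count :
    ∑ ρ, type3Count (ladermanW (ZMod 2)) (ladermanU (ZMod 2)) (ladermanV (ZMod 2)) ρ = 35 := by
  decide

/-- … covering all `27` type-3 terms: `23` of them are produced by exactly one product and `4` by
exactly three (an odd number each, as "all terms of type 3 have to survive" over `ℤ₂`,
`heuleKauersSeidl2019_type3_survive`). [cite: HeuleKauersSeidl2019, §2 and §4] -/
theorem laderman_type3_multiplicities :
    (Finset.univ.filter fun q : Fin 3 × Fin 3 × Fin 3 =>
        (Finset.univ.filter fun ρ : LadermanIndex =>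
          q ∈ type3Produced (ladermanW (ZMod 2)) (ladermanU (ZMod 2)) (ladermanV (ZMod 2)) ρ).card = 1).card
        = 23 ∧
      (Finset.univ.filter fun q : Fin 3 × Fin 3 × Fin 3 =>
        (Finset.univ.filter fun ρ : LadermanIndex =>
          q ∈ type3Produced (ladermanW (ZMod 2)) (ladermanU (ZMod 2)) (ladermanV (ZMod 2)) ρ).card = 3).card
        = 4 := by
  constructor <;> decide

end Laderman

end Literature.Computability.AlgebraicComplexity
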